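import Summits.ResolutionOfSingularities.ResolutionOfSingularities.Theorems.HilbertSamuelEliminationSigmaMaxModificationsCorridor3CPFramePropagationChartAlong
import HarnessLib

/-!
# [OURS · L1 W4.2] D18 (G8): the link G6 (b) RE-PROVED WITH THE FRAME-TRANSITION MAP — the chart presentation over `x_n` read on
# `R[(z)/z_{j₀}][X']/(h')`, the presentation FACTORING through `β₂` with `β₂(r) = r`, `β₂(X̄) = z_{j₀}·X̄'`
# (cell res-hironaka, LADDER-RESOLUTION rung L; slot W4.2, crux chain w42 `SigmaMaxModificationsCorridor3` stmt-ResolutionOfSingularities-19249;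
# `--supports stmt-ResolutionOfSingularities-19249 --as helper`; res-L1-w42-plan-1 RULING v3.14-42 part 2 (KG)(2) «(G8) E-adapted propagation»;
# hand res-D-brk-3 (gen 7), file F2b of DESIGN 17:06:09Z)

PURE COMMUTATIVE ALGEBRA, 0 `def`s, every declaration PROVED; OURS bookkeeping; NOT a statement of Hironaka's manuscript [Hironaka2017] nor of
[CossartJannsenSaito2020]/[CossartPiltant2019]. AI-written, weaker than expert review.

* `exists_adjoinRoot_chart_presentation_along_tracked` — the landed `exists_adjoinRoot_chart_presentation_along` (p547159) with one more
  conclusion: a ring map `β₂ : (B[J/g])_{𝔔'} → (S[X]/(h'))_{𝔔₃}` (`B = R[X]/(h)`, `S = R[(z)/z_{j₀}]`) with `ψ₃ = β₂ ∘ ψ'` and, for every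
  `q ∈ R[X]`, `β₂(q̄) = q(z_{j₀} X')` with coefficients mapped to `S` — the chart change `(B[J/g])_{𝔔'} ≅ (B[J/ū_{j₀}])_{𝔔''}` (G3a,
  compatible with `B`) followed by the inverse of the monic-transform isomorphism `S[X']/(h') ≅ B[J/ū_{j₀}]` (p526498, `X ↦ u_{j₀} X'`)
  localised. Proof = the landed proof verbatim, keeping the two compatibilities it discarded.

References: Stacks 0804/0805 [StacksProject]; CP 2019 Prop. 2.6, (2.7) [CossartPiltant2019]; CJS LNM 2270 Thm. 2.3 [CossartJannsenSaito2020].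
-/

noncomputable section

set_option linter.dupNamespace false

open IsLocalRing IsLocalization Polynomial
open Literature.AlgebraicGeometry.Resolution
open Summit.ResolutionOfSingularities.ResolutionOfSingularities.Theorems.SigmaMaxModificationsCorridor3.Moving

universe u

namespace Summit.ResolutionOfSingularities.ResolutionOfSingularities.Theorems.SigmaMaxModificationsCorridor3.Helpers

set_option maxHeartbeats 1600000 in
-- many subalgebra / localisation coercions (affine blowup algebras of a quotient of a polynomial ring); elaboration is slow (as in G5 (ii-b))
/-- [OURS · L1 W4.2] **The presentation at a point over `x_n`, read on the transformed frame `R[(z)/z_{j₀}][X']/(h')`, for an adapted centre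
`V(X, z)` of any dimension — WITH the transition map `β₂`.** See the module docstring. [cite: StacksProject, Tag 0804] [cite: CossartPiltant2019, Prop. 2.6 and (2.7) (arXiv v1 pp. 13–14)] -/
theorem exists_adjoinRoot_chart_presentation_along_tracked {R : Type u} [CommRing R] [IsRegularLocalRing R] {d l : ℕ}
    (hdim : ringKrullDim R = (d + l : ℕ)) (z : Fin d → R) (y : Fin l → R)
    (hzy : Ideal.span (Set.range (Fin.append z y)) = maximalIdeal R) {h : R[X]} (hmo : h.Monic)
    (hcoJ : ∀ i < h.natDegree, h.coeff i ∈ Ideal.span (Set.range z) ^ (h.natDegree - i)) [IsLocalRing (R[X] ⧸ Ideal.span {h})]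
    (J : Ideal (R[X] ⧸ Ideal.span {h}))
    (hJ : J = ((Ideal.span (Set.range z)).map (C : R →+* R[X]) ⊔ Ideal.span {X}).map (Ideal.Quotient.mk (Ideal.span {h})))
    {g : R[X] ⧸ Ideal.span {h}} (hg : g ∈ J) (𝔔' : Ideal (blowupAlgebra J g)) [𝔔'.IsPrime]
    (h𝔔' : 𝔔'.comap (algebraMap (R[X] ⧸ Ideal.span {h}) (blowupAlgebra J g)) = maximalIdeal (R[X] ⧸ Ideal.span {h}))
    {O₀ : Type u} [CommRing O₀] [IsLocalRing O₀] (ψ' : O₀ →+* Localization.AtPrime 𝔔')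
    (hflat : @RingHom.Flat O₀ (Localization.AtPrime 𝔔') _ _ ψ') (hloc : IsLocalHom ψ')
    (hmap : (maximalIdeal O₀).map ψ' = maximalIdeal (Localization.AtPrime 𝔔'))
    (hres : Function.Surjective ((residue (Localization.AtPrime 𝔔')).comp ψ')) :
    ∃ (j₀ : Fin d) (h' : (blowupAlgebra (Ideal.span (Set.range z)) (z j₀))[X]) (𝔔₃ : Ideal (AdjoinRoot h')) (_ : 𝔔₃.IsPrime)
      (ψ₃ : O₀ →+* Localization.AtPrime 𝔔₃),
      h'.Monic ∧ h'.natDegree = h.natDegree ∧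
      (∀ i ∈ Finset.Icc 1 h.natDegree, h'.coeff (h.natDegree - i) *
        algebraMap R (blowupAlgebra (Ideal.span (Set.range z)) (z j₀)) (z j₀) ^ i =
          algebraMap R (blowupAlgebra (Ideal.span (Set.range z)) (z j₀)) (h.coeff (h.natDegree - i))) ∧
      ((𝔔₃.comap (AdjoinRoot.mk h')).comap C).comap (algebraMap R (blowupAlgebra (Ideal.span (Set.range z)) (z j₀))) = maximalIdeal R ∧
      @RingHom.Flat O₀ (Localization.AtPrime 𝔔₃) _ _ ψ₃ ∧ IsLocalHom ψ₃ ∧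
      (maximalIdeal O₀).map ψ₃ = maximalIdeal (Localization.AtPrime 𝔔₃) ∧
      Function.Surjective ((residue (Localization.AtPrime 𝔔₃)).comp ψ₃) ∧
      ∃ β : Localization.AtPrime 𝔔' →+* Localization.AtPrime 𝔔₃,
        (∀ o, ψ₃ o = β (ψ' o)) ∧
        ∀ q : R[X], β (algebraMap (blowupAlgebra J g) (Localization.AtPrime 𝔔')
            (algebraMap (R[X] ⧸ Ideal.span {h}) (blowupAlgebra J g) (Ideal.Quotient.mk (Ideal.span {h}) q))) =
          algebraMap (AdjoinRoot h') (Localization.AtPrime 𝔔₃)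
            (AdjoinRoot.mk h' (eval₂ (C.comp (algebraMap R (blowupAlgebra (Ideal.span (Set.range z)) (z j₀))))
              (C (algebraMap R (blowupAlgebra (Ideal.span (Set.range z)) (z j₀)) (z j₀)) * X) q)) := by
  subst hJ
  -- `𝔪_B ∩ R = 𝔪_R`
  haveI : IsLocalRing (AdjoinRoot h) := ‹IsLocalRing (R[X] ⧸ Ideal.span {h})›
  have hcomapR : ((maximalIdeal (R[X] ⧸ Ideal.span {h})).comap (Ideal.Quotient.mk (Ideal.span {h}))).comap C = maximalIdeal R :=
    comap_C_comap_mk_maximalIdeal (h := h) hmo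
  -- the generators `w = x`, `v_j = z̄_j` of `J` and the monic relation
  set w : (R[X] ⧸ Ideal.span {h}) := Ideal.Quotient.mk (Ideal.span {h}) X with hw
  set v : Fin d → (R[X] ⧸ Ideal.span {h}) := fun j => Ideal.Quotient.mk (Ideal.span {h}) (C (z j)) with hv
  have hwJ : w ∈ (((Ideal.span (Set.range z)).map (C : R →+* R[X]) ⊔ Ideal.span {X}).map (Ideal.Quotient.mk (Ideal.span {h}))) := Ideal.mem_map_of_mem _ (Ideal.mem_sup_right (Ideal.subset_span rfl))
  have hvJ : ∀ j, v j ∈ (((Ideal.span (Set.range z)).map (C : R →+* R[X]) ⊔ Ideal.span {X}).map (Ideal.Quotient.mk (Ideal.span {h}))) := fun j =>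
    Ideal.mem_map_of_mem _ (Ideal.mem_sup_left (Ideal.mem_map_of_mem _ (Ideal.subset_span ⟨j, rfl⟩)))
  have hspanv : Ideal.span (Set.range v) = (Ideal.span (Set.range z)).map ((Ideal.Quotient.mk (Ideal.span {h})).comp C) := by
    rw [Ideal.map_span, ← Set.range_comp]
    rfl
  have hJPeq : (((Ideal.span (Set.range z)).map (C : R →+* R[X]) ⊔ Ideal.span {X}).map (Ideal.Quotient.mk (Ideal.span {h}))) = Ideal.span (insert w (Set.range v)) := by
    rw [Ideal.span_insert, hspanv, Ideal.map_sup, Ideal.map_map, Ideal.map_span _ {X}, Set.image_singleton, sup_comm]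
  have hrel : w ^ h.natDegree + ∑ i ∈ Finset.range h.natDegree, Ideal.Quotient.mk (Ideal.span {h}) (C (h.coeff i)) * w ^ i = 0 := by
    have h1 : Ideal.Quotient.mk (Ideal.span {h}) (X ^ h.natDegree + ∑ i ∈ Finset.range h.natDegree, C (h.coeff i) * X ^ i) = 0 := by
      rw [← hmo.as_sum, Ideal.Quotient.eq_zero_iff_mem]
      exact Ideal.subset_span rfl
    rw [map_add, map_pow, map_sum] at h1
    simp_rw [map_mul, map_pow] at h1
    exact h1
  have hc : ∀ i < h.natDegree, Ideal.Quotient.mk (Ideal.span {h}) (C (h.coeff i)) ∈ Ideal.span (Set.range v) ^ (h.natDegree - i) := by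
    intro i hi
    rw [hspanv, ← Ideal.map_pow]
    exact Ideal.mem_map_of_mem _ (hcoJ i hi)
  -- G3b: some `ū_{j₀}/g ∉ 𝔔'`
  obtain ⟨j₀, hj₀⟩ := blowupAlgebra.exists_div_not_mem_of_relation (((Ideal.span (Set.range z)).map (C : R →+* R[X]) ⊔ Ideal.span {X}).map (Ideal.Quotient.mk (Ideal.span {h}))) hwJ hvJ (hJPeq ▸ hg) hc hrel 𝔔'
  -- G3a: move to the `ū_{j₀}`-chart
  obtain ⟨𝔔'', h𝔔''p, -, hiff, e₁, he₁⟩ :=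
    blowupAlgebra.exists_atPrime_ringEquiv_of_not_mem (((Ideal.span (Set.range z)).map (C : R →+* R[X]) ⊔ Ideal.span {X}).map (Ideal.Quotient.mk (Ideal.span {h}))) hg (hvJ j₀) 𝔔' hj₀
  have h𝔔''c : 𝔔''.comap (algebraMap (R[X] ⧸ Ideal.span {h}) (blowupAlgebra (((Ideal.span (Set.range z)).map (C : R →+* R[X]) ⊔ Ideal.span {X}).map (Ideal.Quotient.mk (Ideal.span {h}))) (v j₀))) =
      maximalIdeal (R[X] ⧸ Ideal.span {h}) := by
    ext r
    rw [Ideal.mem_comap, hiff, ← Ideal.mem_comap, h𝔔']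
  -- the monic transform and the chart isomorphism (p526498)
  have hrsop : IsRsopPart z := ⟨inferInstance, l, y, hdim, by rw [← range_fin_append, hzy]⟩
  have key := exists_monic_transform_ringEquiv z (J := Finset.univ) (j₀ := j₀) hmo
    (fun i hi => by
      rw [Finset.coe_univ, Set.image_univ]
      have hi' := Finset.mem_Icc.mp hi
      have := hcoJ (h.natDegree - i) (by omega)
      rwa [show h.natDegree - (h.natDegree - i) = i by omega] at this)
    (by rw [Finset.coe_univ, Set.image_univ]; exact prime_algebraMap_blowupAlgebra_of_isRsopPart hrsop j₀)
  rw [Finset.coe_univ, Set.image_univ] at key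
  obtain ⟨h', hmon', hdeg', hcoef', e, he⟩ := key
  -- the prime on `S[X]/(h')` and the transported localisation
  set 𝔔₃ : Ideal (AdjoinRoot h') :=
    𝔔''.comap (e : AdjoinRoot h' →+* blowupAlgebra (((Ideal.span (Set.range z)).map (C : R →+* R[X]) ⊔ Ideal.span {X}).map (Ideal.Quotient.mk (Ideal.span {h}))) (v j₀)) with h𝔔₃
  haveI h𝔔₃p : 𝔔₃.IsPrime := Ideal.comap_isPrime _ _
  have hM : 𝔔₃.primeCompl.map e.toMonoidHom = 𝔔''.primeCompl := by
    ext y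
    simp only [Submonoid.mem_map, Ideal.mem_primeCompl_iff]
    constructor
    · rintro ⟨x, hx, rfl⟩
      exact fun hy => hx (Ideal.mem_comap.mpr hy)
    · intro hy
      refine ⟨e.symm y, fun hx => hy ?_, e.apply_symm_apply y⟩
      have := Ideal.mem_comap.mp hx
      rwa [RingHom.coe_coe, e.apply_symm_apply] at this
  let e₃ : Localization.AtPrime 𝔔₃ ≃+* Localization.AtPrime 𝔔'' :=
    IsLocalization.ringEquivOfRingEquiv (M := 𝔔₃.primeCompl) (T := 𝔔''.primeCompl) (Localization.AtPrime 𝔔₃)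
      (Localization.AtPrime 𝔔'') e hM
  -- the presentation on the transformed frame
  obtain ⟨hf₁, hl₁, hm₁, hr₁⟩ := presentation_comp_ringEquiv (T := Localization.AtPrime 𝔔') (T' := Localization.AtPrime 𝔔'')
    ψ' hflat hloc hmap hres e₁
  obtain ⟨hf₂, hl₂, hm₂, hr₂⟩ := presentation_comp_ringEquiv (T := Localization.AtPrime 𝔔'') (T' := Localization.AtPrime 𝔔₃)
    _ hf₁ hl₁ hm₁ hr₁ e₃.symm
  refine ⟨j₀, h', 𝔔₃, h𝔔₃p, _, hmon', hdeg', hcoef', ?_, hf₂, hl₂, hm₂, hr₂, ?_⟩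
  · -- `𝔔₃` lies over `𝔪_R`
    ext r
    have h1 := he (C r)
    rw [eval₂_C, RingHom.comp_apply] at h1
    have h2 := (SetLike.ext_iff.mp h𝔔''c (Ideal.Quotient.mk (Ideal.span {h}) (C r))).symm
    rw [Ideal.mem_comap, Ideal.mem_comap, Ideal.mem_comap, h𝔔₃, Ideal.mem_comap, RingHom.coe_coe, ← hcomapR, Ideal.mem_comap,
      Ideal.mem_comap, h2, Ideal.mem_comap, h1]
  · -- the transition map `β₂ = e₃⁻¹ ∘ e₁`
    refine ⟨(e₃.symm : Localization.AtPrime 𝔔'' →+* Localization.AtPrime 𝔔₃).comp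
        (e₁ : Localization.AtPrime 𝔔' →+* Localization.AtPrime 𝔔''),
      fun o => by rw [RingHom.comp_apply, RingHom.comp_apply, RingHom.comp_apply], fun q => ?_⟩
    rw [RingHom.comp_apply]
    simp only [RingHom.coe_coe]
    rw [he₁, ← he q, RingEquiv.symm_apply_eq]
    exact (IsLocalization.ringEquivOfRingEquiv_eq hM _).symm

end Summit.ResolutionOfSingularities.ResolutionOfSingularities.Theorems.SigmaMaxModificationsCorridor3.Helpers

end
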